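import Literature.Barriers.CriticalPhenomena.PlaquetteWalkHoleRootThinSide
import HarnessLib

/-!
# Barrier catalogue (SAWScalingLimit): SHUT ROW — removing the single cell below the far cell's southern neighbour EMPTIES
the under route (the corner cell may stay), and the far-cell defect keeps one strict sign on the whole hexagonal range

Leaf of `PlaquetteWalkHoleRootThinSide` (route emptiness on a thin side, the re-drawn block witnesses at every position,
weight positivity in the open range). The quadrant pocket lemma of `PlaquetteWalkHoleRootStructuralKillQuadrant` shuts the
door of the far cell's column at the kill row `w.2 − 2` through the ABSENCE OF THE KILL CELL `K_S2 = (w.1 − 3, w.2 − 2)`; the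
same door is shut when its OTHER face, the cell `(w.1 − 2, w.2 − 2)` below `farSW w`, is absent — §1
`ΩG.exists_excursion_arc_farSW_W_of_AJ_ne_zero_shutRow` (the pocket lemma with `killSW w ∉ D ∨ (w.1 − 2, w.2 − 2) ∉ D`,
proof verbatim). But when that cell is absent the forced double co-corner in `farSW w` needs it as a door: so §2 ★★★★
`ΩG.WE_eq_excursionWinding_of_under_farSWS` — hole absent, `(w.1 − 2, w.2 − 2)` absent, no western door of the far cell's
column below the kill row ⇒ NO wound class-`B2a` under-walk at the far cell, WHETHER OR NOT `K_S2` is present (the thin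
side of the parent file is the case «`K_S2` absent too»); the under route mass vanishes identically; row mirror for
`(w.1 − 2, w.2 + 2)`. §3: with the two over blocks present, ★★★★★ `Im VF(θ) > 0` for every `θ ∈ [π/3, 2π/3]` and the vertex
functional has no zero on the range (`im_vertexFunctional_printed_pos_of_farSWS`, `vertexFunctional_printed_ne_zero_of_farSWS`).
§4, all boxes with the hole TWO rows above the bottom wall (`h.2 = 2`, the LAW L frames): removing the bottom-wall cell
`(h.1 − 1, 0)` below the far cell's southern neighbour — one of the lane's twelve «residual» non-corner boundary cells —
does NOT kill in LAW L's sense but EMPTIES the under route: ★★★★★ `lawL_box_farSWS_vertexFunctional_ne_zero` (VF(θ) ≠ 0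
for all θ ∈ [π/3, 2π/3]), `lawL_box_farSWS_not_wound_under`; top-wall mirror `lawL_box_farNWN_…`. (Kit datum j283492 of
the lane: in `7×5 ∖ {hole, (2,0)}` no `w₁`- or `w₂`-free wound under-walk exists up to 44 arcs — here: none at all, in
every domain; the neighbouring residual cells `(3,0)`, `(4,0)` empty the under route too by the datum, through the
prefix, not typed here.)

Not in print; venture lane «pcv-sawmu», seat b-step0 gen 26.

References: A. Glazman, I. Manolescu, arXiv:1708.00395v3, §1 (Fig. 1, Fig. 2), §2.1, §4.2 and Lemma 2.1
[GlazmanManolescu2019]; A. Glazman, Electron. Commun. Probab. 20 (2015) no. 86, Lemma 3.1, proof pp. 6–7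
[Glazman2015WeightedSAW]; R. Courant, H. Robbins, *What is Mathematics?* (1941/1958), Ch. V Appendix §2 (the even–odd
rule) [CourantRobbins1958].
-/

noncomputable section

open Set Function Complex

namespace Literature.Probability.RandomPlanarGeometry.SAW.YangBaxter

open Real
open Literature.Barriers.CriticalPhenomena.PlaquetteWalk (mirrorRowFace mirrorRowFace_mirrorRowFace)

namespace ΩG

variable {D : Set Face} {w : Face}

/-! ## §1 The pocket lemma with the kill row's door shut from either side -/

/-- ★★ **THE POCKET LEMMA WITH THE KILL ROW'S DOOR SHUT FROM EITHER SIDE.** As the quadrant form of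
`PlaquetteWalkHoleRootStructuralKillQuadrant`, but the door of the far cell's column at the kill row `w.2 − 2` may be
shut by the absence of EITHER of its faces — the kill cell `K_S2 = (w.1 − 3, w.2 − 2)` OR the cell `(w.1 − 2, w.2 − 2)`
below `farSW w`: hole absent, that door shut, the western doors below the kill row unusable ⇒ the excursion of a wound
class-`B2a` under-walk at the far cell has an arc in `farSW w` through its `W` side (proof verbatim, one case split).
[cite: CourantRobbins1958, Ch. V Appendix §2 (the even–odd rule)] [cite: Glazman2015WeightedSAW, Lemma 3.1 (proof, pp. 6–7)] -/
theorem exists_excursion_arc_farSW_W_of_AJ_ne_zero_shutRow (hh : holeFaceW w ∉ D)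
    (hrow : killSW w ∉ D ∨ ((w.1 - 2, w.2 - 2) : Face) ∉ D)
    (hcol : ∀ y : ℤ, y ≤ w.2 - 3 → (w.1 - 3, y) ∉ D ∨ (w.1 - 2, y) ∉ D ∨
      (((w.1 - 4, y) : Face) ∉ D ∧ ((w.1 - 3, y - 1) : Face) ∉ D ∧ ((w.1 - 3, y + 1) : Face) ∉ D))
    (ω : ΩG D (w.side .W) (farW w)) (hr : RootedFace D (w.side .W) (farW w)) (h : ω.IsB2a)
    (hS : ω.2.firstSideG = .S) (hA : ω.AJ hr h (toC (midPt (w.side .W))) ≠ 0) :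
    ∃ k, ω.2.firstHitG < k ∧ k < ω.2.arcs.length ∧ ω.2.fc k = farSW w ∧ (ω.2.sIn k = .W ∨ ω.2.sOut k = .W) := by
  obtain ⟨k, hk1, -, hk2, he⟩ := ω.exists_nth_isEastEdgeSW_of_AJ_ne_zero hh hr h hS hA
  have hF := ω.fh_lt h
  set F := ω.2.firstHitG with hFdef
  set n := ω.2.arcs.length with hndef
  -- the east edge `nth k = vert (w.1 - 2) y`
  cases hnth : ω.2.nth k with
  | slant x y => rw [hnth] at he; exact absurd he (by simp [IsEastEdgeSW])
  | vert x y =>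
    rw [hnth] at he
    simp only [IsEastEdgeSW] at he
    obtain ⟨hx, hy⟩ := he
    -- it is a door: both faces `(w.1 - 3, y)`, `(w.1 - 2, y)` lie in `D` ⇒ `y = w.2 - 1`
    have hdoor := ω.2.door_nth (j := k) (by omega) (by omega)
    rw [hnth] at hdoor
    simp only [MidEdge.faces] at hdoor
    have hy1 : y = w.2 - 1 := by
      rcases lt_or_eq_of_le hy with hlt | heq
      · exfalso
        rcases lt_or_eq_of_le (show y ≤ w.2 - 2 by omega) with hlt2 | heq2
        · rw [hx] at hdoor
          have e3 : ((w.1 - 3, y) : Face) = (w.1 - 2 - 1, y) := Prod.ext (by show w.1 - 3 = w.1 - 2 - 1; ring) rfl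
          rcases hcol y (by omega) with hc | hc | ⟨hcW, hcS, hcN⟩
          · exact hc (by rw [e3]; exact hdoor.1)
          · exact hc hdoor.2
          · -- the western cell `c = (w.1 - 3, y)` is a dead end: no arc of the walk lies in it, yet one of the arcs
            -- `k - 1`, `k` does (they are the two faces of the crossed edge)
            set c : Face := (w.1 - 3, y) with hcdef
            have hcw : ((c.1 - 1, c.2) : Face) ∉ D := by
              have e : ((c.1 - 1, c.2) : Face) = (w.1 - 4, y) := Prod.ext (by show w.1 - 3 - 1 = w.1 - 4; ring) rfl
              rw [e]; exact hcW
            have hcs : ((c.1, c.2 - 1) : Face) ∉ D := hcS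
            have hcn : ((c.1, c.2 + 1) : Face) ∉ D := hcN
            have hout := (ω.2.side_sIn_nth (i := k - 1) (by omega)).2.1
            have hin := (ω.2.side_sIn_nth (i := k) (by omega)).1
            rw [show k - 1 + 1 = k by omega, hnth] at hout
            rw [hnth] at hin
            have hf1 := (Face.exists_side_eq_iff _ _).1 ⟨_, hout⟩
            have hf2 := (Face.exists_side_eq_iff _ _).1 ⟨_, hin⟩
            simp only [MidEdge.faces] at hf1 hf2
            rw [hx, ← e3] at hf1 hf2
            have hne : ω.2.fc (k - 1) ≠ ω.2.fc (k - 1 + 1) := YBWalk.fc_succ_ne (by omega)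
            rw [show k - 1 + 1 = k by omega] at hne
            rcases hf1 with e1 | e1
            · exact ω.fc_ne_of_deadEnd c hcw hcs hcn (i := k - 1) (by omega) (by omega) e1
            · rcases hf2 with e2 | e2
              · -- arc `k` lies in `c`: it is not the last arc (the last arc leaves through a side of the far cell)
                have hkn : k + 1 < n := by
                  rcases Nat.lt_or_ge (k + 1) n with hl | hl
                  · exact hl
                  · exfalso
                    have hlast := (ω.2.side_sIn_nth (i := k) (by omega)).2.1
                    rw [show k + 1 = n by omega, ω.2.nth_length, e2] at hlast
                    have hq := not_inQuadSW_of_side_farW w hlast (fun e => by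
                      have := congrArg Prod.fst e
                      simp only [hcdef, farW] at this
                      omega)
                    exact hq ⟨by simp [hcdef], by show y ≤ w.2 - 1; omega⟩
                exact ω.fc_ne_of_deadEnd c hcw hcs hcn (i := k) (by omega) hkn e2
              · exact hne (e1.trans e2.symm)
        · rcases hrow with hK | hK
          · apply hK
            have e : killSW w = (x - 1, y) := by rw [hx, heq2]; simp [killSW]; ring
            rw [e]; exact hdoor.1
          · apply hK
            have e : ((w.1 - 2, w.2 - 2) : Face) = (x, y) := by rw [hx, heq2]
            rw [e]; exact hdoor.2
      · exact heq
    -- so `nth k` is the `W` side of the cell below the far cell; arcs `k - 1` and `k` lie in the pocket and in that cell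
    have hgW : ω.2.nth k = (farSW w).side .W := by
      rw [hnth, hx, hy1]; obtain ⟨a, c⟩ := w; simp [farSW, Face.side]
    have hout := (ω.2.side_sIn_nth (i := k - 1) (by omega)).2.1
    have hin := (ω.2.side_sIn_nth (i := k) (by omega)).1
    rw [show k - 1 + 1 = k by omega, hgW] at hout
    rw [hgW] at hin
    have hf1 := (Face.exists_side_eq_iff _ _).1 ⟨_, hout⟩
    have hf2 := (Face.exists_side_eq_iff _ _).1 ⟨_, hin⟩
    rw [← pocketSW_side_E, pocketSW_side_E_faces] at hf1 hf2
    simp only at hf1 hf2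
    have hne : ω.2.fc (k - 1) ≠ ω.2.fc (k - 1 + 1) := YBWalk.fc_succ_ne (by omega)
    rw [show k - 1 + 1 = k by omega] at hne
    rcases hf2 with e2 | e2
    · -- arc `k` lies in the pocket, so arc `k - 1` lies in `farSW w` and exits `W`
      have e1 : ω.2.fc (k - 1) = farSW w := by
        rcases hf1 with e | e
        · exact absurd (e.trans e2.symm) hne
        · exact e
      exact ⟨k - 1, by omega, by omega, e1, Or.inr (Face.side_injective (farSW w) (by rw [e1] at hout; exact hout))⟩
    · exact ⟨k, by omega, by omega, e2, Or.inl (Face.side_injective (farSW w) (by rw [e2] at hin; exact hin))⟩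

/-! ## §2 The under route is empty when the cell below `farSW` is absent -/

/-- The faces of the bottom side of the cell below the far cell. [cite: GlazmanManolescu2019, §1 (the lattice of rhombi and its mid-edges)] -/
private theorem farSW_side_S_faces_shut (w : Face) : ((farSW w).side .S).faces = (((w.1 - 2, w.2 - 2) : Face), farSW w) := by
  obtain ⟨a, b⟩ := w
  simp only [farSW, Face.side, MidEdge.faces, Prod.mk.injEq, and_true, true_and]
  ring

/-- ★★★★ **THE UNDER ROUTE IS EMPTY ONCE THE CELL BELOW `farSW` IS ABSENT** — whether or not the corner cell `K_S2` is
present: hole absent, `(w.1 − 2, w.2 − 2) ∉ D`, no western door of the far cell's column below the kill row ⇒ no class-`B2a`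
under-walk at the far cell is wound, at any angle. (The shut-row pocket lemma forces an excursion arc in `farSW w` through
`W`, hence two co-corner arcs there, filling its four sides; the `{W,S}` one would cross the `S` side — a door onto the
absent cell.) [cite: GlazmanManolescu2019, §1 (Fig. 1, Fig. 2), Lemma 2.1] [cite: Glazman2015WeightedSAW, Lemma 3.1 (proof, pp. 6–7)]
[cite: CourantRobbins1958, Ch. V Appendix §2 (the even–odd rule)] -/
theorem WE_eq_excursionWinding_of_under_farSWS (hh : holeFaceW w ∉ D) (hB : ((w.1 - 2, w.2 - 2) : Face) ∉ D)
    (hcol : ∀ y : ℤ, y ≤ w.2 - 3 → (w.1 - 3, y) ∉ D ∨ (w.1 - 2, y) ∉ D)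
    (ω : ΩG D (w.side .W) (farW w)) (hr : RootedFace D (w.side .W) (farW w)) (h : ω.IsB2a)
    (hS : ω.2.firstSideG = .S) (θ : ℝ) :
    ω.WE (fun _ => θ) = excursionWinding θ ω.2.firstSideG (ω.z1 hr h) ω.1 := by
  by_contra hW
  have hcol3 : ∀ y : ℤ, y ≤ w.2 - 3 → (w.1 - 3, y) ∉ D ∨ (w.1 - 2, y) ∉ D ∨
      (((w.1 - 4, y) : Face) ∉ D ∧ ((w.1 - 3, y - 1) : Face) ∉ D ∧ ((w.1 - 3, y + 1) : Face) ∉ D) :=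
    fun y hy => (hcol y hy).elim Or.inl fun h' => Or.inr (Or.inl h')
  -- two co-corner arcs in `farSW w`, for `ω` or its reverse
  have hk : ω.2.kindsIn (farSW w) = [.coCorner, .coCorner] := by
    rcases ω.AJ_ne_zero_or_rev_of_wound hr h θ hW with hA | hA
    · obtain ⟨k, hFk, hkn, hfck, hkW⟩ :=
        ω.exists_excursion_arc_farSW_W_of_AJ_ne_zero_shutRow hh (Or.inr hB) hcol3 hr h hS hA
      exact ω.kindsIn_farSW_eq_of_excursion_arc_W h hS hFk hkn hfck hkW
    · have h' := ω.rev_isB2a hr h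
      have hS' : (ω.rev hr).2.firstSideG = .S := (ω.rev_firstSide hr h).trans hS
      obtain ⟨k, hFk, hkn, hfck, hkW⟩ :=
        (ω.rev hr).exists_excursion_arc_farSW_W_of_AJ_ne_zero_shutRow hh (Or.inr hB) hcol3 hr h' hS' hA
      have hk := (ω.rev hr).kindsIn_farSW_eq_of_excursion_arc_W h' hS' hFk hkn hfck hkW
      have hperm := ω.kindsIn_rev_perm hr h (farSW_ne_farW w)
      rw [hk] at hperm
      have hp : (ω.2.kindsIn (farSW w)).Perm (List.replicate 2 .coCorner) := hperm.symm
      exact List.perm_replicate.1 hp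
  -- as in the thin side: the two arcs fill the four sides, none may use `S`
  obtain ⟨i, j, hij, hj, hfi, hfj⟩ :=
    ω.2.exists_two_arcs_of_two_le_length_kindsIn (f := farSW w) (by rw [hk]; simp)
  have hi : i < ω.2.arcs.length := by omega
  have hcc : ∀ {k : ℕ} (hk' : k < ω.2.arcs.length), ω.2.fc k = farSW w →
      arcKind (ω.2.sIn k) (ω.2.sOut k) = .coCorner := by
    intro k hk' hfk
    have hm := ω.2.arcKind_mem_kindsIn hk'
    rw [hfk, hk] at hm
    simpa using hm
  have noS : ∀ {k : ℕ} (hk' : k < ω.2.arcs.length), ω.2.fc k = farSW w → ω.2.sIn k ≠ .S ∧ ω.2.sOut k ≠ .S := by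
    intro k hk' hfk
    obtain ⟨h1, h2, -⟩ := ω.2.side_sIn_nth hk'
    rw [hfk] at h1 h2
    constructor
    · intro e
      rw [e] at h1
      have hk0 : 0 < k := by
        rcases Nat.eq_zero_or_pos k with e0 | hpos
        · exfalso
          rw [e0, YBWalk.nth_zero] at h1
          exact root_ne_farSW_side_S w h1.symm
        · exact hpos
      have hd := ω.2.door_nth hk0 hk'
      rw [← h1, farSW_side_S_faces_shut] at hd
      exact hB hd.1
    · intro e
      rw [e] at h2
      rcases Nat.lt_or_ge (k + 1) ω.2.arcs.length with hlt | hge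
      · have hd := ω.2.door_nth (j := k + 1) (by omega) hlt
        rw [← h2, farSW_side_S_faces_shut] at hd
        exact hB hd.1
      · have ek : k + 1 = ω.2.arcs.length := by omega
        rw [ek, YBWalk.nth_length] at h2
        exact farW_side_ne_farSW_side_S w ω.1 h2.symm
  have hN : ∀ {k : ℕ} (hk' : k < ω.2.arcs.length), ω.2.fc k = farSW w →
      ω.2.nth k = (farSW w).side .N ∨ ω.2.nth (k + 1) = (farSW w).side .N := by
    intro k hk' hfk
    obtain ⟨h1, h2, -⟩ := ω.2.side_sIn_nth hk'
    rw [hfk] at h1 h2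
    obtain ⟨n1, n2⟩ := noS hk' hfk
    rcases coCorner_side_N_of_ne_S (hcc hk' hfk) n1 n2 with e | e
    · left; rw [← h1, e]
    · right; rw [← h2, e]
  have hij1 : i + 1 ≠ j := by
    intro e
    have hne := ω.2.fc_succ_ne (i := i) (by omega)
    rw [e, hfi, hfj] at hne
    exact hne rfl
  have hn := ω.2.length_arcs
  rcases hN hi hfi with ei | ei <;> rcases hN hj hfj with ej | ej
  · have := ω.2.nth_inj (by omega) (by omega) (ei.trans ej.symm); omega
  · have := ω.2.nth_inj (by omega) (by omega) (ei.trans ej.symm); omega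
  · have := ω.2.nth_inj (by omega) (by omega) (ei.trans ej.symm); omega
  · have := ω.2.nth_inj (by omega) (by omega) (ei.trans ej.symm); omega

/-- ★★★ The under route mass vanishes identically once the cell below `farSW` is absent. [cite: GlazmanManolescu2019, Lemma 2.1 (statement, "in the form given in [Gl]")] -/
theorem sum_routeMassW_S_eq_zero_of_farSWS [Finite D] (hh : holeFaceW w ∉ D) (hB : ((w.1 - 2, w.2 - 2) : Face) ∉ D)
    (hcol : ∀ y : ℤ, y ≤ w.2 - 3 → (w.1 - 3, y) ∉ D ∨ (w.1 - 2, y) ∉ D) (hr : RootedFace D (w.side .W) (farW w))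
    (θ : ℝ) : ∑ ω ∈ setB2a D (w.side .W) (farW w), routeMassW θ hr .S ω = 0 := by
  classical
  refine Finset.sum_eq_zero fun ω _ => ?_
  unfold routeMassW
  split_ifs with h1 h2
  · exact absurd (WE_eq_excursionWinding_of_under_farSWS hh hB hcol ω hr h1 h2.1 θ) h2.2
  · rfl
  · rfl

/-- The reflection on a cell, in coordinates. [cite: GlazmanManolescu2019, §4.2 (lattice symmetries)] -/
private theorem mirrorRowFace_mkR (w : Face) (x y : ℤ) : mirrorRowFace w.2 ((x, y) : Face) = (x, 2 * w.2 - y) := by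
  simp [mirrorRowFace]

/-- ★★★★ **THE OVER ROUTE IS EMPTY ONCE THE CELL ABOVE `farNW` IS ABSENT** (row mirror).
[cite: GlazmanManolescu2019, §1 (Fig. 1, Fig. 2), §4.2 (lattice symmetries), Lemma 2.1] [cite: Glazman2015WeightedSAW, Lemma 3.1 (proof, pp. 6–7)] -/
theorem WE_eq_excursionWinding_of_over_farNWN (hh : holeFaceW w ∉ D) (hB : ((w.1 - 2, w.2 + 2) : Face) ∉ D)
    (hcol : ∀ y : ℤ, w.2 + 3 ≤ y → (w.1 - 3, y) ∉ D ∨ (w.1 - 2, y) ∉ D)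
    (ω : ΩG D (w.side .W) (farW w)) (hr : RootedFace D (w.side .W) (farW w)) (h : ω.IsB2a)
    (hN : ω.2.firstSideG = .N) (θ : ℝ) :
    ω.WE (fun _ => θ) = excursionWinding θ ω.2.firstSideG (ω.z1 hr h) ω.1 := by
  by_contra hW
  have hr' := rootedFace_rowMirrorDom w hr
  have h' := ω.mirrorFar_isB2a hr h
  have hh' : holeFaceW w ∉ rowMirrorDom w D := by rwa [mem_rowMirrorDom, mirrorRowFace_holeFaceW]
  have hcol' : ∀ y : ℤ, y ≤ w.2 - 3 → (w.1 - 3, y) ∉ rowMirrorDom w D ∨ (w.1 - 2, y) ∉ rowMirrorDom w D := by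
    intro y hy
    simp only [mem_rowMirrorDom, mirrorRowFace_mkR]
    exact hcol (2 * w.2 - y) (by omega)
  have hB' : ((w.1 - 2, w.2 - 2) : Face) ∉ rowMirrorDom w D := by
    rw [mem_rowMirrorDom, mirrorRowFace_mkR, show 2 * w.2 - (w.2 - 2) = w.2 + 2 by ring]; exact hB
  have hS' : ω.mirrorFar.2.firstSideG = .S := by rw [mirrorFar_firstSideG, hN]; rfl
  exact absurd (WE_eq_excursionWinding_of_under_farSWS hh' hB' hcol' ω.mirrorFar hr' h' hS' _) (ω.mirrorFar_wound hr h hW)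

/-- ★★★ The over route mass vanishes identically once the cell above `farNW` is absent. [cite: GlazmanManolescu2019, Lemma 2.1 (statement, "in the form given in [Gl]")] -/
theorem sum_routeMassW_N_eq_zero_of_farNWN [Finite D] (hh : holeFaceW w ∉ D) (hB : ((w.1 - 2, w.2 + 2) : Face) ∉ D)
    (hcol : ∀ y : ℤ, w.2 + 3 ≤ y → (w.1 - 3, y) ∉ D ∨ (w.1 - 2, y) ∉ D) (hr : RootedFace D (w.side .W) (farW w))
    (θ : ℝ) : ∑ ω ∈ setB2a D (w.side .W) (farW w), routeMassW θ hr .N ω = 0 := by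
  classical
  refine Finset.sum_eq_zero fun ω _ => ?_
  unfold routeMassW
  split_ifs with h1 h2
  · exact absurd (WE_eq_excursionWinding_of_over_farNWN hh hB hcol ω hr h1 h2.1 θ) h2.2
  · rfl
  · rfl

end ΩG

end Literature.Probability.RandomPlanarGeometry.SAW.YangBaxter

namespace Literature.Barriers.CriticalPhenomena.PlaquetteWalk

open Literature.Probability.RandomPlanarGeometry.SAW.YangBaxter
open Real Complex

/-! ## §3 One strict sign on the whole hexagonal range -/

section Signs

variable {Dl : List Face} {w : Face}

/-- ★★★★★ **CELL BELOW `farSW` ABSENT ⇒ `Im VF(θ) > 0` FOR EVERY `θ ∈ [π/3, 2π/3]`** (hole absent, no western door below the kill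
row, both over blocks present; the corner cell `K_S2` may be present). [cite: GlazmanManolescu2019, Lemma 2.1 (statement, "in the form given in [Gl]"), §1 eq. (1)]
[cite: Glazman2015WeightedSAW, Lemma 3.1 (proof, pp. 6–7)] [cite: CourantRobbins1958, Ch. V Appendix §2 (the even–odd rule)] -/
theorem im_vertexFunctional_printed_pos_of_farSWS {θ : ℝ} (hθ : θ ∈ Set.Icc (π / 3) (2 * π / 3))
    (hBW : ∀ c ∈ overBlockW w, c ∈ Dl) (hBE : ∀ c ∈ overBlockE w, c ∈ Dl)
    (hf : farW w ∈ Dl) (hh : holeFaceW w ∉ dom Dl) (hT : ((w.1 - 2, w.2 - 2) : Face) ∉ dom Dl)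
    (hcolS : ∀ y : ℤ, y ≤ w.2 - 3 → (w.1 - 3, y) ∉ dom Dl ∨ (w.1 - 2, y) ∉ dom Dl) :
    0 < (vertexFunctional (printedWeights θ) tFiveEighths (ybCoeff θ) Dl (w.side .W) (farW w)).im := by
  have hr : RootedFace (dom Dl) (w.side .W) (farW w) := ⟨hf, fun hb => hh (by rw [root_faces_W] at hb; exact hb.1)⟩
  have hkill : ∀ (ω : ΩG (dom Dl) (w.side .W) (farW w)) (h : ω.IsB2a), ω.2.firstSideG = .S →
      ω.WE (fun _ => θ) ≠ excursionWinding θ ω.2.firstSideG (ω.z1 hr h) ω.1 → ¬ω.2.W2FreeOff (farW w) :=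
    fun ω h hS hW => absurd (ΩG.WE_eq_excursionWinding_of_under_farSWS hh hT hcolS ω hr h hS θ) hW
  have hkill1 : ∀ (ω : ΩG (dom Dl) (w.side .W) (farW w)) (h : ω.IsB2a), ω.2.firstSideG = .S →
      ω.WE (fun _ => θ) ≠ excursionWinding θ ω.2.firstSideG (ω.z1 hr h) ω.1 → ¬ω.2.W1FreeOff (farW w) :=
    fun ω h hS hW => absurd (ΩG.WE_eq_excursionWinding_of_under_farSWS hh hT hcolS ω hr h hS θ) hW
  rcases eq_or_lt_of_le hθ.1 with e1 | h1
  · subst e1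
    exact im_vertexFunctional_printed_farCellW_pi_div_three_pos_of_under_killed Dl w hf hh hr hkill
      (exists_over_w2free_of_overBlockW hBW hr _)
  rcases eq_or_lt_of_le hθ.2 with e2 | h2
  · subst e2
    exact im_vertexFunctional_printed_farCellW_two_pi_div_three_pos_of_under_killed Dl w hf hh hr hkill1
      (exists_over_w1free_of_overBlockE hBE hr _)
  have hθo : θ ∈ Set.Ioo (π / 3) (2 * π / 3) := ⟨h1, h2⟩
  rw [vertexFunctional_printed_farCellW_im_eq hθ Dl w hf hh hr, ΩG.sum_routeMassW_S_eq_zero_of_farSWS hh hT hcolS hr θ,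
    sub_zero]
  obtain ⟨ω, h, hN, hW, -⟩ := exists_over_w2free_of_overBlockW hBW hr θ
  exact mul_pos (weightV_pos_of_mem_Ioo ⟨by linarith [hθo.1, Real.pi_pos], by linarith [hθo.2, Real.pi_pos]⟩)
    (ΩG.sum_routeMassW_pos_of_wound hr .N hθo ⟨ω, h, hN, hW⟩)

/-- ★★★★★ **CELL BELOW `farSW` ABSENT ⇒ NO ZERO OF THE FAR-CELL VERTEX FUNCTIONAL ON `[π/3, 2π/3]`.**
[cite: GlazmanManolescu2019, Lemma 2.1 (statement, "in the form given in [Gl]")] [cite: Glazman2015WeightedSAW, Lemma 3.1 (proof, pp. 6–7)] -/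
theorem vertexFunctional_printed_ne_zero_of_farSWS {θ : ℝ} (hθ : θ ∈ Set.Icc (π / 3) (2 * π / 3))
    (hBW : ∀ c ∈ overBlockW w, c ∈ Dl) (hBE : ∀ c ∈ overBlockE w, c ∈ Dl)
    (hf : farW w ∈ Dl) (hh : holeFaceW w ∉ dom Dl) (hT : ((w.1 - 2, w.2 - 2) : Face) ∉ dom Dl)
    (hcolS : ∀ y : ℤ, y ≤ w.2 - 3 → (w.1 - 3, y) ∉ dom Dl ∨ (w.1 - 2, y) ∉ dom Dl) :
    vertexFunctional (printedWeights θ) tFiveEighths (ybCoeff θ) Dl (w.side .W) (farW w) ≠ 0 := by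
  intro e
  have hpos := im_vertexFunctional_printed_pos_of_farSWS hθ hBW hBE hf hh hT hcolS
  rw [e, Complex.zero_im] at hpos
  exact lt_irrefl _ hpos

/-- ★★★★★ **CELL ABOVE `farNW` ABSENT ⇒ `Im VF(θ) < 0` FOR EVERY `θ ∈ [π/3, 2π/3]`** (row mirror; both under blocks present).
[cite: GlazmanManolescu2019, Lemma 2.1 (statement, "in the form given in [Gl]"), §1 eq. (1)] [cite: Glazman2015WeightedSAW, Lemma 3.1 (proof, pp. 6–7)] -/
theorem im_vertexFunctional_printed_neg_of_farNWN {θ : ℝ} (hθ : θ ∈ Set.Icc (π / 3) (2 * π / 3))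
    (hBW : ∀ c ∈ underBlockW w, c ∈ Dl) (hBE : ∀ c ∈ underBlockE w, c ∈ Dl)
    (hf : farW w ∈ Dl) (hh : holeFaceW w ∉ dom Dl) (hT : ((w.1 - 2, w.2 + 2) : Face) ∉ dom Dl)
    (hcolN : ∀ y : ℤ, w.2 + 3 ≤ y → (w.1 - 3, y) ∉ dom Dl ∨ (w.1 - 2, y) ∉ dom Dl) :
    (vertexFunctional (printedWeights θ) tFiveEighths (ybCoeff θ) Dl (w.side .W) (farW w)).im < 0 := by
  have hr : RootedFace (dom Dl) (w.side .W) (farW w) := ⟨hf, fun hb => hh (by rw [root_faces_W] at hb; exact hb.1)⟩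
  have hkill : ∀ (ω : ΩG (dom Dl) (w.side .W) (farW w)) (h : ω.IsB2a), ω.2.firstSideG = .N →
      ω.WE (fun _ => θ) ≠ excursionWinding θ ω.2.firstSideG (ω.z1 hr h) ω.1 → ¬ω.2.W2FreeOff (farW w) :=
    fun ω h hN hW => absurd (ΩG.WE_eq_excursionWinding_of_over_farNWN hh hT hcolN ω hr h hN θ) hW
  have hkill1 : ∀ (ω : ΩG (dom Dl) (w.side .W) (farW w)) (h : ω.IsB2a), ω.2.firstSideG = .N →
      ω.WE (fun _ => θ) ≠ excursionWinding θ ω.2.firstSideG (ω.z1 hr h) ω.1 → ¬ω.2.W1FreeOff (farW w) :=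
    fun ω h hN hW => absurd (ΩG.WE_eq_excursionWinding_of_over_farNWN hh hT hcolN ω hr h hN θ) hW
  rcases eq_or_lt_of_le hθ.1 with e1 | h1
  · subst e1
    exact im_vertexFunctional_printed_farCellW_pi_div_three_neg_of_over_killed Dl w hf hh hr hkill
      (exists_under_w2free_of_underBlockE hBE hr _)
  rcases eq_or_lt_of_le hθ.2 with e2 | h2
  · subst e2
    exact im_vertexFunctional_printed_farCellW_two_pi_div_three_neg_of_over_killed Dl w hf hh hr hkill1
      (exists_under_w1free_of_underBlockW hBW hr _)
  have hθo : θ ∈ Set.Ioo (π / 3) (2 * π / 3) := ⟨h1, h2⟩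
  rw [vertexFunctional_printed_farCellW_im_eq hθ Dl w hf hh hr, ΩG.sum_routeMassW_N_eq_zero_of_farNWN hh hT hcolN hr θ,
    zero_sub, mul_neg, neg_lt_zero]
  obtain ⟨ω, h, hS, hW, -⟩ := exists_under_w2free_of_underBlockE hBE hr θ
  exact mul_pos (weightV_pos_of_mem_Ioo ⟨by linarith [hθo.1, Real.pi_pos], by linarith [hθo.2, Real.pi_pos]⟩)
    (ΩG.sum_routeMassW_pos_of_wound hr .S hθo ⟨ω, h, hS, hW⟩)

end Signs

/-! ## §4 LAW L's residual bottom cell below the far cell's southern neighbour, all boxes -/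

section Boxes

variable {m n : ℕ} {h : Face}

/-- The two over blocks sit in the box with the hole two rows above the bottom wall minus the bottom cell `(h.1 − 1, 0)`.
[cite: GlazmanManolescu2019, §2.1 (finite domains of faces), §4.2 (translation invariance)] -/
theorem overBlocks_hroot_subset_boxMinus_farSWS (hW : 2 ≤ h.1) (hE : h.1 + 3 ≤ m) (hS : h.2 = 2) (hN : h.2 + 3 ≤ n) :
    (∀ c ∈ overBlockW (h.1 + 1, h.2), c ∈ boxMinus m n [h, (h.1 - 1, 0)]) ∧
      (∀ c ∈ overBlockE (h.1 + 1, h.2), c ∈ boxMinus m n [h, (h.1 - 1, 0)]) := by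
  have bW : ∀ c ∈ overBlockW42, 1 ≤ c.1 ∧ c.1 ≤ 5 ∧ 1 ≤ c.2 ∧ c.2 ≤ 4 ∧ c ≠ (3, 2) := by decide
  have bE : ∀ c ∈ overBlockE42, 1 ≤ c.1 ∧ c.1 ≤ 5 ∧ 1 ≤ c.2 ∧ c.2 ≤ 4 ∧ c ≠ (3, 2) := by decide
  constructor
  · intro c hc
    simp only [overBlockW, List.mem_map] at hc
    obtain ⟨a, ha, rfl⟩ := hc
    obtain ⟨b1, b2, b3, b4, b5⟩ := bW a ha
    obtain ⟨x, y⟩ := a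
    simp only [ne_eq, Prod.mk.injEq, not_and] at b1 b2 b3 b4 b5
    rw [shiftBy_refShift_mk, mem_boxMinus]
    simp only [List.mem_cons, List.not_mem_nil, or_false, not_or]
    refine ⟨⟨by omega, by omega, by omega, by omega⟩, fun e => ?_, fun e => ?_⟩
    · have e' := Prod.ext_iff.1 e; simp only at e'; omega
    · have e' := Prod.ext_iff.1 e; simp only at e'; omega
  · intro c hc
    simp only [overBlockE, List.mem_map] at hc
    obtain ⟨a, ha, rfl⟩ := hc
    obtain ⟨b1, b2, b3, b4, b5⟩ := bE a ha
    obtain ⟨x, y⟩ := a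
    simp only [ne_eq, Prod.mk.injEq, not_and] at b1 b2 b3 b4 b5
    rw [shiftBy_refShift_mk, mem_boxMinus]
    simp only [List.mem_cons, List.not_mem_nil, or_false, not_or]
    refine ⟨⟨by omega, by omega, by omega, by omega⟩, fun e => ?_, fun e => ?_⟩
    · have e' := Prod.ext_iff.1 e; simp only at e'; omega
    · have e' := Prod.ext_iff.1 e; simp only at e'; omega

/-- ★★★★★ **LAW L's RESIDUAL CELL BELOW `farSW`, ALL BOXES: `VF(θ) ≠ 0` FOR EVERY `θ ∈ [π/3, 2π/3]`.** In the `m × n` box with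
the hole `h` TWO rows above the bottom wall (`h.2 = 2`, `2 ≤ h.1`, `h.1 + 3 ≤ m`, `h.2 + 3 ≤ n`), removing the bottom cell
`(h.1 − 1, 0)` alone neither kills a route nor leaves both routes alive: it EMPTIES the under route, and the far-cell defect is
strictly positive in imaginary part — in particular non-zero — on the whole hexagonal range.
[cite: GlazmanManolescu2019, Lemma 2.1 (statement, "in the form given in [Gl]"), §2.1] [cite: Glazman2015WeightedSAW, Lemma 3.1 (proof, pp. 6–7)] -/
theorem lawL_box_farSWS_vertexFunctional_ne_zero (hW : 2 ≤ h.1) (hE : h.1 + 3 ≤ m) (hS : h.2 = 2) (hN : h.2 + 3 ≤ n)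
    {θ : ℝ} (hθ : θ ∈ Set.Icc (π / 3) (2 * π / 3)) :
    vertexFunctional (printedWeights θ) tFiveEighths (ybCoeff θ) (boxMinus m n [h, (h.1 - 1, 0)])
      (Face.side (h.1 + 1, h.2) .W) (farW (h.1 + 1, h.2)) ≠ 0 := by
  obtain ⟨hBW, hBE⟩ := overBlocks_hroot_subset_boxMinus_farSWS (m := m) (n := n) hW hE hS hN
  refine vertexFunctional_printed_ne_zero_of_farSWS hθ hBW hBE ?_ ?_ ?_ fun y hy => ?_
  · rw [mem_boxMinus]; simp only [farW, List.mem_cons, List.not_mem_nil, or_false, not_or]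
    refine ⟨⟨by omega, by omega, by omega, by omega⟩, fun e => ?_, fun e => ?_⟩
    · have e' := Prod.ext_iff.1 e; simp only at e'; omega
    · have e' := Prod.ext_iff.1 e; simp only at e'; omega
  · rw [holeFaceW_hroot]; exact not_mem_dom_boxMinus_of_mem (by simp)
  · have e : (((h.1 + 1, h.2).1 - 2, (h.1 + 1, h.2).2 - 2) : Face) = (h.1 - 1, 0) :=
      Prod.ext (by simp only; omega) (by simp only; omega)
    rw [e]; exact not_mem_dom_boxMinus_of_mem (by simp)
  · left; intro hm; have hb := (mem_dom_boxMinus.1 hm).1; simp only at hb hy; omega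

/-- ★★★★ **… and its under route is EMPTY** (no wound class-`B2a` under-walk at the far cell, any angle).
[cite: GlazmanManolescu2019, §1 (Fig. 1, Fig. 2), Lemma 2.1] [cite: Glazman2015WeightedSAW, Lemma 3.1 (proof, pp. 6–7)] -/
theorem lawL_box_farSWS_not_wound_under (hS : h.2 = 2)
    (hr : RootedFace (dom (boxMinus m n [h, (h.1 - 1, 0)])) (Face.side (h.1 + 1, h.2) .W) (farW (h.1 + 1, h.2)))
    (ω : ΩG (dom (boxMinus m n [h, (h.1 - 1, 0)])) (Face.side (h.1 + 1, h.2) .W) (farW (h.1 + 1, h.2))) (hb : ω.IsB2a)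
    (hfs : ω.2.firstSideG = .S) (θ : ℝ) :
    ω.WE (fun _ => θ) = excursionWinding θ ω.2.firstSideG (ω.z1 hr hb) ω.1 := by
  refine ΩG.WE_eq_excursionWinding_of_under_farSWS ?_ ?_ (fun y hy => ?_) ω hr hb hfs θ
  · rw [holeFaceW_hroot]; exact not_mem_dom_boxMinus_of_mem (by simp)
  · have e : (((h.1 + 1, h.2).1 - 2, (h.1 + 1, h.2).2 - 2) : Face) = (h.1 - 1, 0) :=
      Prod.ext (by simp only; omega) (by simp only; omega)
    rw [e]; exact not_mem_dom_boxMinus_of_mem (by simp)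
  · left; intro hm; have hb' := (mem_dom_boxMinus.1 hm).1; simp only at hb' hy; omega

end Boxes

end Literature.Barriers.CriticalPhenomena.PlaquetteWalk
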